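import Summits.QuantumFields.YangMills.Theorems.AlphaInputsT3ACv3AbelianSmall
import HarnessLib

/-!
# `AlphaInputsT3ACv3LinearLiftProfile` — (LL) STEP L1: THE ONE-DIMENSIONAL DUAL PROFILES OF THE EXACT LINEAR LIFT (spreading operator with EXACT block averages,
# partition of unity and the chain identity, uniformly in the block side) — cell `ym3-torus`, width seat `ym-ust-19936-w2` (g0), OWNER re-point 2026-08-27T23:08Z

WHY.  DEPMAP v3.3 displays the one W-dependent kinematic row of 2′∕2′χ as (FL); for ABELIAN data alpha-2's `fineLift_of_linearLift_abelian` (p581514) reduces (FL) to the LINEAR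
REGIONAL LIFT (LL): a finest one-form with EXACT `k`-fold (0.4)-linear averages and fine curls `≤ B_lin·ε·L^{−2k}`.  The lift is built from a translation-covariant spreading
`S¹A = Σ_b A(b)·(τ ⊗ σ ⊗ σ)` whose one-dimensional profiles must satisfy, EXACTLY and for every block side `n = L^k`: (i) cell sums `Σ_{|t| ≤ h} σ(t + jn) = n·δ_{j0}`
(exact block averages of 0-forms), (ii) partition of unity `Σ_j σ(· + jn) ≡ 1`, (iii) the chain identity `σ(s+1) − σ(s) = τ(s+n) − τ(s)` (so that `d ∘ S⁰ = S¹ ∘ d`,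
`curl ∘ S¹ = S² ∘ curl`), (iv) segment biorthogonality `(1/n) Σ_{|t| ≤ h} Σ_{m<n} τ(t + m − jn) = δ_{j0}` (exact transported-segment means of 1-forms), with (v) `|τ| ≤ 6/n`,
`|σ| ≤ 6`, supports inside `(−n, n)` resp. `(0, n)` — the smoothness that spreads a coarse curl over `n²` fine plaquettes.  THIS FILE constructs them for every `n = 2h + 1`:
`ρ` = the even two-plateau step function (`+α` on `|u| ≤ p`, `−β` on `p < |u| ≤ 2p`, `p = ⌊n/6⌋`, `α = n(3p+1)/(4p²+3p+1)`, `β = α(p+1)/(3p+1)`: total mass `n`, vanishing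
half-moment `Σ u₊ρ(u) = 0`), `σ := (𝟙_{[−h,h]} ∗ ρ)/n`, `τ(s) := ρ(s − h)/n`; everything reduces to ONE identity `Σ_u ρ(u)·(n − |jn − u|)₊ = n²·δ_{j0}` (`weightSum_eq`).
* §1 definitions (`side`, `prad`, `alpha`, `beta`, `rho`, `box`, `rsupp`, `sigma`, `tau`, `wt`), the two moment identities (`sum_rho`, `sum_rho_pos`), bounds (`alpha_le_six`,
  `abs_rho_le`).
* §2 ★ `weightSum_eq`.  The four identities (i)–(iv) and the bounds (v) are the sibling `AlphaInputsT3ACv3LinearLiftProfileIds` (same seat, filed together).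
Pure real∕integer bookkeeping (no lattice objects yet); the tensor spreading on `T_η`, the identification `linAvgIter k = M^k − dΨ_k` and the lift itself are the files
L2–L5 of this seat's plan (HOME `ym3-torus/ym-ust-19936-w2/LL-PLAN-w2-g0.md`).
HONEST FRAMING.  Elementary; nothing of [Balaban1985UV3]∕[Balaban1985Variational]∕[Balaban1987RG1] is asserted; count-neutral helper toward the (FL) row of 2′∕2′χ
(`--supports stmt-QuantumFields-19936`); registry untouched.  YM₃ on the torus is a RUNG of the programme, not the Clay problem; no claim about d = 4, infinite volume or a mass gap.

References: T. Bałaban, Commun. Math. Phys. 109 (1987) 249–301 [Balaban1987RG1] ((0.4) p.253: the linear block average whose exact right inverse these profiles furnish);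
Commun. Math. Phys. 102 (1985) 277–309 [Balaban1985Variational] (Thm 1 (8) p.279: the regularity window `B₃ε₁L^{−2j}` the lift must meet).
-/

set_option autoImplicit false

noncomputable section

namespace Summit.QuantumFields.YangMills.Theorems.LinearLiftProfile

open Finset

/-! ## §1 The profiles -/

variable (h : ℕ)

/-- The block side `n = 2h + 1` (odd; `n = L^k`, `h = (L^k − 1)/2`). [cite: Balaban1987RG1, (0.1) p.251] -/
def side : ℕ := 2 * h + 1

/-- The inner plateau radius `p = ⌊n/6⌋`. [folklore] -/
def prad : ℕ := side h / 6

/-- The inner plateau height `α = n(3p+1)/(4p²+3p+1)` (so that the total mass is `n`). [folklore] -/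
def alpha : ℝ := (side h : ℝ) * (3 * (prad h : ℝ) + 1) / (4 * (prad h : ℝ) ^ 2 + 3 * (prad h : ℝ) + 1)

/-- The outer plateau depth `β = α(p+1)/(3p+1)` (so that the half-moment vanishes). [folklore] -/
def beta : ℝ := alpha h * ((prad h : ℝ) + 1) / (3 * (prad h : ℝ) + 1)

/-- **THE DUAL DENSITY `ρ`**: the even two-plateau step function `+α` on `|u| ≤ p`, `−β` on `p < |u| ≤ 2p`, `0` beyond. [folklore] -/
def rho (u : ℤ) : ℝ :=
  if -(prad h : ℤ) ≤ u ∧ u ≤ (prad h : ℤ) then alpha h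
  else if -(2 * (prad h : ℤ)) ≤ u ∧ u ≤ 2 * (prad h : ℤ) then -beta h else 0

/-- The indicator of the centred cell `[−h, h]` (the `n` fine sites of a block, as offsets from its centre). [cite: Balaban1987RG1, (0.1) p.252] -/
def box (s : ℤ) : ℝ := if -(h : ℤ) ≤ s ∧ s ≤ (h : ℤ) then 1 else 0

/-- The support interval `[−2p, 2p]` of `ρ` as a `Finset`. [folklore] -/
def rsupp : Finset ℤ := Icc (-(2 * (prad h : ℤ))) (2 * (prad h : ℤ))

/-- **THE 0-FORM PROFILE `σ = (𝟙_{[−h,h]} ∗ ρ)/n`.** [folklore] -/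
def sigma (s : ℤ) : ℝ := ((side h : ℝ))⁻¹ * ∑ u ∈ rsupp h, rho h u * box h (s - u)

/-- **THE 1-FORM PROFILE `τ(s) = ρ(s − h)/n`** (the dual density re-centred at the face between cell `0` and cell `1`). [folklore] -/
def tau (s : ℤ) : ℝ := ((side h : ℝ))⁻¹ * rho h (s - (h : ℤ))

/-- The triangular weight `(n − |jn − u|)₊`: the number of fine sites common to the cell `[−h,h]` and its translate by `jn − u`. [folklore] -/
def wt (j u : ℤ) : ℤ := max ((side h : ℤ) - |j * (side h : ℤ) - u|) 0

/-! ### Elementary facts about the parameters -/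

/-- `n > 0`. [folklore] -/
theorem side_pos : 0 < side h := by unfold side; omega

/-- `n = 2h + 1` over `ℤ`. [folklore] -/
theorem side_int : (side h : ℤ) = 2 * (h : ℤ) + 1 := by unfold side; push_cast; ring

/-- `n = 2h + 1` over `ℝ`. [folklore] -/
theorem side_real : (side h : ℝ) = 2 * (h : ℝ) + 1 := by unfold side; push_cast; ring

/-- `n > 0` over `ℝ`. [folklore] -/
theorem side_real_pos : (0 : ℝ) < side h := by exact_mod_cast side_pos h

/-- `6p ≤ n ≤ 6p + 5`. [folklore] -/
theorem prad_bounds : 6 * prad h ≤ side h ∧ side h ≤ 6 * prad h + 5 := by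
  unfold prad; omega

/-- `2p ≤ h` (the support of `ρ` fits in half a cell). [folklore] -/
theorem two_prad_le : 2 * prad h ≤ h := by
  have := prad_bounds h; unfold side at this; omega

/-- `4p + 1 ≤ n`. [folklore] -/
theorem four_prad_succ_le : 4 * prad h + 1 ≤ side h := by
  have := prad_bounds h; unfold side at this ⊢; omega

/-- The denominator of `α` is positive. [folklore] -/
theorem denom_pos : (0 : ℝ) < 4 * (prad h : ℝ) ^ 2 + 3 * (prad h : ℝ) + 1 := by positivity

/-- `3p + 1 > 0`. [folklore] -/
theorem three_prad_pos : (0 : ℝ) < 3 * (prad h : ℝ) + 1 := by positivity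

/-- `α ≥ 0`. [folklore] -/
theorem alpha_nonneg : 0 ≤ alpha h := by
  unfold alpha; exact div_nonneg (by positivity) (denom_pos h).le

/-- `α ≤ 6` (from `n ≤ 6p + 5`). [folklore] -/
theorem alpha_le_six : alpha h ≤ 6 := by
  unfold alpha
  rw [div_le_iff₀ (denom_pos h)]
  have hn : (side h : ℝ) ≤ 6 * (prad h : ℝ) + 5 := by exact_mod_cast (prad_bounds h).2
  have hp0 : (0 : ℝ) ≤ (prad h : ℝ) := Nat.cast_nonneg _
  rcases Nat.eq_zero_or_pos (prad h) with hp | hp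
  · rw [hp] at hn ⊢; push_cast at hn ⊢; nlinarith
  · have hp1 : (1 : ℝ) ≤ (prad h : ℝ) := by exact_mod_cast hp
    nlinarith [mul_nonneg hp0 hp0, mul_nonneg (sub_nonneg.mpr hp1) hp0]

/-- `β ≥ 0`. [folklore] -/
theorem beta_nonneg : 0 ≤ beta h := by
  unfold beta; exact div_nonneg (mul_nonneg (alpha_nonneg h) (by positivity)) (three_prad_pos h).le

/-- `β ≤ α`. [folklore] -/
theorem beta_le_alpha : beta h ≤ alpha h := by
  unfold beta
  rw [div_le_iff₀ (three_prad_pos h)]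
  have := alpha_nonneg h
  have hp0 : (0 : ℝ) ≤ (prad h : ℝ) := Nat.cast_nonneg _
  nlinarith

/-- The defining relation of `β`: `β(3p+1) = α(p+1)`. [folklore] -/
theorem beta_mul : beta h * (3 * (prad h : ℝ) + 1) = alpha h * ((prad h : ℝ) + 1) := by
  unfold beta; field_simp

/-- The defining relation of `α`: `α(4p²+3p+1) = n(3p+1)`. [folklore] -/
theorem alpha_mul : alpha h * (4 * (prad h : ℝ) ^ 2 + 3 * (prad h : ℝ) + 1) = (side h : ℝ) * (3 * (prad h : ℝ) + 1) := by
  unfold alpha; field_simp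

/-- `|ρ| ≤ 6`. [folklore] -/
theorem abs_rho_le (u : ℤ) : |rho h u| ≤ 6 := by
  unfold rho
  have h1 := alpha_le_six h; have h2 := alpha_nonneg h; have h3 := beta_nonneg h; have h4 := beta_le_alpha h
  split_ifs
  · rw [abs_of_nonneg h2]; exact h1
  · rw [abs_neg, abs_of_nonneg h3]; linarith
  · simp

/-- `ρ` is even. [folklore] -/
theorem rho_neg (u : ℤ) : rho h (-u) = rho h u := by
  unfold rho
  by_cases h1 : -(prad h : ℤ) ≤ u ∧ u ≤ (prad h : ℤ)
  · rw [if_pos h1, if_pos (by omega)]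
  · rw [if_neg h1, if_neg (by omega)]
    by_cases h2 : -(2 * (prad h : ℤ)) ≤ u ∧ u ≤ 2 * (prad h : ℤ)
    · rw [if_pos h2, if_pos (by omega)]
    · rw [if_neg h2, if_neg (by omega)]

/-- `ρ` vanishes off `[−2p, 2p]`. [folklore] -/
theorem rho_eq_zero {u : ℤ} (hu : ¬ (-(2 * (prad h : ℤ)) ≤ u ∧ u ≤ 2 * (prad h : ℤ))) : rho h u = 0 := by
  unfold rho
  rw [if_neg (by omega), if_neg hu]

/-- Membership in the support interval. [folklore] -/
theorem mem_rsupp {u : ℤ} : u ∈ rsupp h ↔ -(2 * (prad h : ℤ)) ≤ u ∧ u ≤ 2 * (prad h : ℤ) := by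
  unfold rsupp; rw [mem_Icc]

/-- Reflection `u ↦ −u` preserves sums over the symmetric support. [folklore] -/
theorem sum_rsupp_neg (f : ℤ → ℝ) : ∑ u ∈ rsupp h, f (-u) = ∑ u ∈ rsupp h, f u := by
  refine sum_nbij' (fun u => -u) (fun u => -u) ?_ ?_ ?_ ?_ ?_
  · intro u hu; rw [mem_rsupp] at hu ⊢; omega
  · intro u hu; rw [mem_rsupp] at hu ⊢; omega
  · intro u _; simp
  · intro u _; simp
  · intro u _; simp

/-! ### The two moment identities -/

/-- The symmetric interval `[−(m+1), m+1]` from `[−m, m]`. [folklore] -/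
theorem Icc_neg_succ (m : ℕ) :
    Icc (-((m + 1 : ℕ) : ℤ)) ((m + 1 : ℕ) : ℤ) = insert (-((m : ℤ) + 1)) (insert ((m : ℤ) + 1) (Icc (-(m : ℤ)) (m : ℤ))) := by
  ext u
  simp only [mem_Icc, mem_insert, Nat.cast_add, Nat.cast_one]
  omega

/-- `#[−m, m] = 2m + 1` (as a real sum). [folklore] -/
theorem sum_Icc_symm_one (m : ℕ) : ∑ _u ∈ Icc (-(m : ℤ)) (m : ℤ), (1 : ℝ) = 2 * (m : ℝ) + 1 := by
  induction m with
  | zero => simp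
  | succ m ih =>
    rw [Icc_neg_succ, sum_insert, sum_insert, ih]
    · push_cast; ring
    · simp only [mem_Icc]; omega
    · simp only [mem_insert, mem_Icc]; omega

/-- `Σ_{|u| ≤ m} u₊ = m(m+1)/2`. [folklore] -/
theorem sum_Icc_symm_pos (m : ℕ) : ∑ u ∈ Icc (-(m : ℤ)) (m : ℤ), ((max u 0 : ℤ) : ℝ) = (m : ℝ) * ((m : ℝ) + 1) / 2 := by
  induction m with
  | zero => simp
  | succ m ih =>
    rw [Icc_neg_succ, sum_insert, sum_insert, ih]
    · have e1 : ((max (-((m : ℤ) + 1)) 0 : ℤ) : ℝ) = 0 := by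
        rw [max_eq_right (by omega)]; simp
      have e2 : ((max ((m : ℤ) + 1) 0 : ℤ) : ℝ) = (m : ℝ) + 1 := by
        rw [max_eq_left (by omega)]; push_cast; ring
      rw [e1, e2]; push_cast; ring
    · simp only [mem_Icc]; omega
    · simp only [mem_insert, mem_Icc]; omega

/-- Restricting a sum over `[−2p, 2p]` to the inner plateau `[−p, p]`. [folklore] -/
theorem sum_rsupp_ite (f : ℤ → ℝ) :
    ∑ u ∈ rsupp h, (if -(prad h : ℤ) ≤ u ∧ u ≤ (prad h : ℤ) then f u else 0) = ∑ u ∈ Icc (-(prad h : ℤ)) (prad h : ℤ), f u := by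
  rw [← sum_filter]
  congr 1
  ext u
  simp only [rsupp, mem_filter, mem_Icc]
  omega

/-- `ρ` on its support as a combination of two plateau indicators: `ρ = (α+β)·𝟙_{|u|≤p} − β` on `[−2p, 2p]`. [folklore] -/
theorem rho_eq_of_mem {u : ℤ} (hu : u ∈ rsupp h) :
    rho h u = (if -(prad h : ℤ) ≤ u ∧ u ≤ (prad h : ℤ) then alpha h + beta h else 0) - beta h := by
  rw [mem_rsupp] at hu
  unfold rho
  by_cases h1 : -(prad h : ℤ) ≤ u ∧ u ≤ (prad h : ℤ)
  · rw [if_pos h1, if_pos h1]; ring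
  · rw [if_neg h1, if_neg h1, if_pos hu]; ring

/-- `#[−2p, 2p] = 4p + 1` (as a real sum). [folklore] -/
theorem sum_rsupp_one : ∑ _u ∈ rsupp h, (1 : ℝ) = 4 * (prad h : ℝ) + 1 := by
  have e := sum_Icc_symm_one (2 * prad h)
  push_cast at e
  unfold rsupp
  rw [e]; ring

/-- **TOTAL MASS `Σ ρ = n`.** [folklore] -/
theorem sum_rho : ∑ u ∈ rsupp h, rho h u = side h := by
  have e1 : ∑ u ∈ rsupp h, (if -(prad h : ℤ) ≤ u ∧ u ≤ (prad h : ℤ) then alpha h + beta h else 0) =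
      (alpha h + beta h) * (2 * (prad h : ℝ) + 1) := by
    rw [sum_rsupp_ite h (fun _ => alpha h + beta h), sum_const, nsmul_eq_mul]
    have hc : ((Icc (-(prad h : ℤ)) (prad h : ℤ)).card : ℝ) = 2 * (prad h : ℝ) + 1 := by
      have e := sum_Icc_symm_one (prad h)
      rw [sum_const, nsmul_eq_mul, mul_one] at e
      exact e
    rw [hc]; ring
  have e2 : ∑ _u ∈ rsupp h, beta h = beta h * (4 * (prad h : ℝ) + 1) := by
    rw [sum_const, nsmul_eq_mul]
    have hc : ((rsupp h).card : ℝ) = 4 * (prad h : ℝ) + 1 := by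
      have e := sum_rsupp_one h
      rw [sum_const, nsmul_eq_mul, mul_one] at e
      exact e
    rw [hc]; ring
  calc ∑ u ∈ rsupp h, rho h u
      = ∑ u ∈ rsupp h, ((if -(prad h : ℤ) ≤ u ∧ u ≤ (prad h : ℤ) then alpha h + beta h else 0) - beta h) :=
        sum_congr rfl fun u hu => rho_eq_of_mem h hu
    _ = (alpha h + beta h) * (2 * (prad h : ℝ) + 1) - beta h * (4 * (prad h : ℝ) + 1) := by rw [sum_sub_distrib, e1, e2]
    _ = side h := by
        have key : (3 * (prad h : ℝ) + 1) * ((alpha h + beta h) * (2 * (prad h : ℝ) + 1) - beta h * (4 * (prad h : ℝ) + 1) - side h) = 0 := by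
          linear_combination (-2 * (prad h : ℝ)) * beta_mul h + alpha_mul h
        have h3 := three_prad_pos h
        rcases mul_eq_zero.mp key with h0 | h0
        · linarith
        · linarith

/-- **VANISHING HALF-MOMENT `Σ u₊ ρ(u) = 0`.** [folklore] -/
theorem sum_rho_pos : ∑ u ∈ rsupp h, rho h u * ((max u 0 : ℤ) : ℝ) = 0 := by
  have e1 : ∑ u ∈ rsupp h, (if -(prad h : ℤ) ≤ u ∧ u ≤ (prad h : ℤ) then (alpha h + beta h) * ((max u 0 : ℤ) : ℝ) else 0) =
      (alpha h + beta h) * ((prad h : ℝ) * ((prad h : ℝ) + 1) / 2) := by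
    rw [sum_rsupp_ite h (fun u => (alpha h + beta h) * ((max u 0 : ℤ) : ℝ)), ← mul_sum, sum_Icc_symm_pos]
  have e2 : ∑ u ∈ rsupp h, beta h * ((max u 0 : ℤ) : ℝ) = beta h * ((2 * (prad h : ℝ)) * (2 * (prad h : ℝ) + 1) / 2) := by
    rw [← mul_sum]
    have e := sum_Icc_symm_pos (2 * prad h)
    rw [show ((2 * prad h : ℕ) : ℤ) = 2 * (prad h : ℤ) by push_cast; ring,
      show ((2 * prad h : ℕ) : ℝ) = 2 * (prad h : ℝ) by push_cast; ring] at e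
    unfold rsupp
    rw [e]
  calc ∑ u ∈ rsupp h, rho h u * ((max u 0 : ℤ) : ℝ)
      = ∑ u ∈ rsupp h, ((if -(prad h : ℤ) ≤ u ∧ u ≤ (prad h : ℤ) then (alpha h + beta h) * ((max u 0 : ℤ) : ℝ) else 0) - beta h * ((max u 0 : ℤ) : ℝ)) := by
        refine sum_congr rfl fun u hu => ?_
        rw [rho_eq_of_mem h hu]
        split_ifs <;> ring
    _ = (alpha h + beta h) * ((prad h : ℝ) * ((prad h : ℝ) + 1) / 2) - beta h * ((2 * (prad h : ℝ)) * (2 * (prad h : ℝ) + 1) / 2) := by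
        rw [sum_sub_distrib, e1, e2]
    _ = 0 := by linear_combination (-(prad h : ℝ) / 2) * beta_mul h

/-- By reflection, `Σ (−u)₊ ρ(u) = 0` as well. [folklore] -/
theorem sum_rho_neg_pos : ∑ u ∈ rsupp h, rho h u * ((max (-u) 0 : ℤ) : ℝ) = 0 := by
  have e := sum_rsupp_neg h (fun v => rho h (-v) * ((max v 0 : ℤ) : ℝ))
  simp only [neg_neg] at e
  rw [e]
  simp_rw [rho_neg]
  exact sum_rho_pos h

/-! ## §2 The weight identity `Σ_u ρ(u)(n − |jn − u|)₊ = n²·δ_{j0}` -/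

/-- On the support, the weight at `j = 0` is `n − |u| = n − u₊ − (−u)₊`. [folklore] -/
theorem wt_zero {u : ℤ} (hu : u ∈ rsupp h) : (wt h 0 u : ℝ) = (side h : ℝ) - ((max u 0 : ℤ) : ℝ) - ((max (-u) 0 : ℤ) : ℝ) := by
  rw [mem_rsupp] at hu
  have h2 := two_prad_le h
  have hn := side_int h
  have key : wt h 0 u = (side h : ℤ) - max u 0 - max (-u) 0 := by
    unfold wt
    rw [zero_mul, zero_sub, abs_neg]
    rcases le_total 0 u with hu0 | hu0
    · rw [abs_of_nonneg hu0, max_eq_left hu0, max_eq_right (by omega : -u ≤ 0), max_eq_left (by omega : (0:ℤ) ≤ (side h : ℤ) - u)]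
      ring
    · rw [abs_of_nonpos hu0, max_eq_right hu0, max_eq_left (by omega : (0:ℤ) ≤ -u), max_eq_left (by omega : (0:ℤ) ≤ (side h : ℤ) - -u)]
      ring
  rw [key]; push_cast; ring

/-- On the support, the weight at `j = 1` is `u₊`. [folklore] -/
theorem wt_one {u : ℤ} (hu : u ∈ rsupp h) : (wt h 1 u : ℝ) = ((max u 0 : ℤ) : ℝ) := by
  rw [mem_rsupp] at hu
  have h2 := two_prad_le h
  have hn := side_int h
  have key : wt h 1 u = max u 0 := by
    unfold wt
    rw [one_mul, abs_of_nonneg (by omega : (0:ℤ) ≤ (side h : ℤ) - u), show (side h : ℤ) - ((side h : ℤ) - u) = u by ring]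
  rw [key]

/-- On the support, the weight at `j = −1` is `(−u)₊`. [folklore] -/
theorem wt_neg_one {u : ℤ} (hu : u ∈ rsupp h) : (wt h (-1) u : ℝ) = ((max (-u) 0 : ℤ) : ℝ) := by
  rw [mem_rsupp] at hu
  have h2 := two_prad_le h
  have hn := side_int h
  have key : wt h (-1) u = max (-u) 0 := by
    unfold wt
    rw [neg_one_mul, show -(side h : ℤ) - u = -((side h : ℤ) + u) by ring, abs_neg,
      abs_of_nonneg (by omega : (0:ℤ) ≤ (side h : ℤ) + u), show (side h : ℤ) - ((side h : ℤ) + u) = -u by ring]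
  rw [key]

/-- On the support, the weight vanishes for `|j| ≥ 2` (the translate is at least a whole cell away). [folklore] -/
theorem wt_eq_zero_of_two_le {j u : ℤ} (hu : u ∈ rsupp h) (hj : 2 ≤ |j|) : wt h j u = 0 := by
  rw [mem_rsupp] at hu
  have h2 := two_prad_le h
  have hn := side_int h
  unfold wt
  apply max_eq_right
  have hJ : (side h : ℤ) ≤ |j * (side h : ℤ) - u| := by
    by_cases hj0 : 0 ≤ j
    · rw [abs_of_nonneg hj0] at hj
      have hmul : 2 * (side h : ℤ) ≤ j * (side h : ℤ) := by nlinarith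
      generalize j * (side h : ℤ) = J at hmul ⊢
      rw [le_abs]; left; omega
    · have hj0 : j < 0 := lt_of_not_ge hj0
      rw [abs_of_neg hj0] at hj
      have hmul : j * (side h : ℤ) ≤ -2 * (side h : ℤ) := by nlinarith
      generalize j * (side h : ℤ) = J at hmul ⊢
      rw [le_abs]; right; omega
  omega

/-- **★ THE WEIGHT IDENTITY**: `Σ_u ρ(u)·(n − |jn − u|)₊ = n²` for `j = 0` and `0` otherwise — exact block averages (cell sums of `σ`) and exact segment means (of `τ`)
both reduce to it. [folklore] -/
theorem weightSum_eq (j : ℤ) : ∑ u ∈ rsupp h, rho h u * (wt h j u : ℝ) = if j = 0 then (side h : ℝ) ^ 2 else 0 := by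
  by_cases hj0 : j = 0
  · subst hj0
    rw [if_pos rfl]
    calc ∑ u ∈ rsupp h, rho h u * (wt h 0 u : ℝ)
        = ∑ u ∈ rsupp h, ((side h : ℝ) * rho h u - rho h u * ((max u 0 : ℤ) : ℝ) - rho h u * ((max (-u) 0 : ℤ) : ℝ)) := by
          refine sum_congr rfl fun u hu => ?_
          rw [wt_zero h hu]; ring
      _ = (side h : ℝ) * ∑ u ∈ rsupp h, rho h u - ∑ u ∈ rsupp h, rho h u * ((max u 0 : ℤ) : ℝ)
            - ∑ u ∈ rsupp h, rho h u * ((max (-u) 0 : ℤ) : ℝ) := by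
          rw [sum_sub_distrib, sum_sub_distrib, mul_sum]
      _ = (side h : ℝ) ^ 2 := by rw [sum_rho, sum_rho_pos, sum_rho_neg_pos]; ring
  · rw [if_neg hj0]
    by_cases hj1 : j = 1
    · subst hj1
      calc ∑ u ∈ rsupp h, rho h u * (wt h 1 u : ℝ) = ∑ u ∈ rsupp h, rho h u * ((max u 0 : ℤ) : ℝ) :=
            sum_congr rfl fun u hu => by rw [wt_one h hu]
        _ = 0 := sum_rho_pos h
    · by_cases hjm : j = -1
      · subst hjm
        calc ∑ u ∈ rsupp h, rho h u * (wt h (-1) u : ℝ) = ∑ u ∈ rsupp h, rho h u * ((max (-u) 0 : ℤ) : ℝ) :=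
              sum_congr rfl fun u hu => by rw [wt_neg_one h hu]
          _ = 0 := sum_rho_neg_pos h
      · have hj2 : 2 ≤ |j| := by
          by_cases h0 : 0 ≤ j
          · rw [abs_of_nonneg h0]; omega
          · rw [abs_of_neg (lt_of_not_ge h0)]; omega
        exact sum_eq_zero fun u hu => by rw [wt_eq_zero_of_two_le h hu hj2]; simp

end Summit.QuantumFields.YangMills.Theorems.LinearLiftProfile

end
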